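import Literature.NumberTheory.EllipticCurves.PeriodIndexKummerPhi
import Literature.NumberTheory.EllipticCurves.KummerUnramifiedConverse
import HarnessLib

/-!
# `Φ(a, b)` vanishes on the inertia groups at places `w ∤ P·a·b` (Clark–Sharif §3.2/§3.6)

`Proofs`-style file (theorems only; no definitions, no named facts) under the provefact seat on
`Literature.NumberTheory.EllipticCurves.ClarkSharif2010_thm2` (Clark–Sharif 2010, Theorem 2),
continuing `PeriodIndexKummerPhi.lean` (the Kummer characters `f_a : 𝔤_k → ℤ/Pℤ` and the classes
`Φ(a, b) ∈ H¹(𝔤_k, E[P])` of Clark–Sharif §2.5/§3.5 in the subgroup model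
`𝔤_k = fixingGal k ≤ 𝔤_K` for an intermediate field `K ⊆ k ⊆ K̄`).

The step formalized here is the unramifiedness half of the local triviality argument at the good
places, Clark–Sharif §3.2 (end of the proof of Theorem 1, re-used verbatim in §3.6 for
Theorem 2: "the proof of Theorem 1 showed that the curves corresponding to `Φ(π_i, 1)` and
`Φ(π_i, π_i')` were trivial at `w`"): *"Now suppose `w ≠ v, v'` is a good prime. […] Since
`K_w((π')^{1/P})/K_w` is unramified, `ξ` trivializes over `K_w^{unr}`."*  In Galois terms: for a
prime `𝔓` of `\bar ℤ = absIntegers (𝓞 K) K` with `P ∉ 𝔓`, and `a, b ∈ k` algebraic integers not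
in `𝔓` (i.e. `w ∤ P a b` for the place `w = 𝔓 ∩ k` of `k`), the Kummer characters `f_a`, `f_b`
and hence the cocycle `Φ(a, b) : n ↦ ρ(f_a(n), f_b(n))` vanish at every `n ∈ 𝔤_k` lying in the
inertia group `I_𝔓 ≤ 𝔤_K` — by the converse Kummer criterion
`Literature.NumberTheory.EllipticCurves.smul_eq_self_of_mem_inertia_of_pow_eq`
(`KummerUnramifiedConverse`: inertia fixes the `P`-th roots of `𝔓`-units when `P ∉ 𝔓`;
Lang, *FDG*, Ch. 6 Prop. 1.3).  The other half of the printed step — an unramified class of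
`H¹(K_w, E)[P]` at a good place is trivial ([LT]; Milne ADT I.3.8) — is the tree's
`Literature.NumberTheory.EllipticCurves.Milne2006_unramifiedClass_eq_zero_holds`.

* `kummerChar_eq_zero_of_mem_inertia` — `f_a(n) = 0` for `n ∈ 𝔤_k ∩ I_𝔓`, `a ∈ k ∩ \bar ℤ`,
  `a ∉ 𝔓`, `P ∉ 𝔓`;
* `unitChar_eq_zero_of_mem_inertia` — the same for `unitChar` of a unit `a ∈ kˣ` which is (the
  image of) an algebraic integer outside `𝔓`;
* `kummerPhiCocycle_apply_eq_zero_of_mem_inertia` — `Φ(a, b)(n) = 0` for such `a, b` and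
  `n ∈ 𝔤_k ∩ I_𝔓`.

## References

* P. L. Clark, S. Sharif, *Period, index and potential Ш*, Algebra & Number Theory 4 (2010)
  151–174, §3.2 (last paragraph of the proof of Theorem 1), §3.6 (last paragraph);
  arXiv:0811.3019 read. [ClarkSharif2010]
* S. Lang, *Fundamentals of Diophantine Geometry* (1983), Ch. 6 Prop. 1.3, p. 123. [Lang1983]
-/

noncomputable section

open scoped Classical NumberField

universe u

namespace Literature.NumberTheory.EllipticCurves

open GaloisRepresentations Field NumberField

variable {K : Type u} [Field K] {k : IntermediateField K (AlgebraicClosure K)} {P : ℕ} [NeZero P]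
  {ζ : AlgebraicClosure K}

/-- **Kummer characters of `𝔓`-units vanish on inertia at `𝔓 ∌ P`.**  Let `K ⊆ k ⊆ K̄`, `ζ` a
primitive `P`-th root of unity, `𝔓` a prime of `\bar ℤ = absIntegers (𝓞 K) K` with `P ∉ 𝔓`,
and `a ∈ k` an algebraic integer with `a ∉ 𝔓`.  Then the Kummer character `f_a` of `a`
vanishes at every `n ∈ 𝔤_k` lying in the inertia group `I_𝔓 ≤ 𝔤_K`: `n` fixes the chosen
`P`-th root of `a` (`smul_eq_self_of_mem_inertia_of_pow_eq`), i.e. `k(a^{1/P})/k` is unramified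
at the place below `𝔓`.  Clark–Sharif §3.2: "Since `K_w((π')^{1/P})/K_w` is unramified, `ξ`
trivializes over `K_w^{unr}`"; Lang, *FDG*, Ch. 6 Prop. 1.3.
[cite: ClarkSharif2010, §3.2 (proof of Thm. 1, last paragraph)] [cite: Lang1983, Ch. 6 Prop. 1.3] -/
theorem kummerChar_eq_zero_of_mem_inertia (hζ : IsPrimitiveRoot ζ P)
    {a : absIntegers (𝓞 K) K} (ha : (a : AlgebraicClosure K) ∈ k)
    {𝔓 : Ideal (absIntegers (𝓞 K) K)} [𝔓.IsPrime] (ha𝔓 : a ∉ 𝔓)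
    (hP𝔓 : ((P : ℕ) : absIntegers (𝓞 K) K) ∉ 𝔓) {n : fixingGal k}
    (hn : (n : absoluteGaloisGroup K) ∈ 𝔓.inertia (absoluteGaloisGroup K)) :
    kummerChar k P ζ (a : AlgebraicClosure K) n = 0 := by
  have ha0 : (a : AlgebraicClosure K) ≠ 0 := fun h ↦ by
    have : a = 0 := Subtype.ext h
    exact ha𝔓 (this ▸ 𝔓.zero_mem)
  have hαint : IsIntegral (𝓞 K) (pthRoot P (a : AlgebraicClosure K)) :=
    IsIntegral.of_pow (NeZero.pos P) (by rw [pthRoot_pow]; exact a.2)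
  let α : absIntegers (𝓞 K) K := ⟨pthRoot P (a : AlgebraicClosure K), hαint⟩
  have hα : α ^ P = a := Subtype.ext (by
    change pthRoot P (a : AlgebraicClosure K) ^ P = a
    exact pthRoot_pow P _)
  have hna : (n : absoluteGaloisGroup K) • a = a :=
    Subtype.ext (fixingGal_smul_eq_self n ha)
  have h := smul_eq_self_of_mem_inertia_of_pow_eq 𝔓 hP𝔓 ha𝔓 hα hn hna
  have h' : (n : absoluteGaloisGroup K) • pthRoot P (a : AlgebraicClosure K) =
      pthRoot P (a : AlgebraicClosure K) := congrArg Subtype.val h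
  refine kummerChar_eq_of_smul_pthRoot_eq hζ ha ha0 n ?_
  rw [rootPow_zero, one_mul]
  exact h'

/-- **`unitChar` of a `𝔓`-unit vanishes on inertia at `𝔓 ∌ P`**: the case of a unit `a ∈ kˣ`
which is the image of an algebraic integer `x ∈ \bar ℤ` with `x ∉ 𝔓` (in Clark–Sharif: the
generator `π'` of a principal prime `v' ≠ w` of `𝓞_k`, at a good place `w ∤ P`).
[cite: ClarkSharif2010, §3.2 (proof of Thm. 1, last paragraph)] [cite: Lang1983, Ch. 6 Prop. 1.3] -/
theorem unitChar_eq_zero_of_mem_inertia (hζ : IsPrimitiveRoot ζ P) (a : (↥k)ˣ)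
    {x : absIntegers (𝓞 K) K} (hx : (x : AlgebraicClosure K) = ((a : k) : AlgebraicClosure K))
    {𝔓 : Ideal (absIntegers (𝓞 K) K)} [𝔓.IsPrime] (hx𝔓 : x ∉ 𝔓)
    (hP𝔓 : ((P : ℕ) : absIntegers (𝓞 K) K) ∉ 𝔓) {n : fixingGal k}
    (hn : (n : absoluteGaloisGroup K) ∈ 𝔓.inertia (absoluteGaloisGroup K)) :
    unitChar P ζ a n = 0 := by
  rw [unitChar, ← hx]
  exact kummerChar_eq_zero_of_mem_inertia hζ (hx ▸ units_coe_mem a) hx𝔓 hP𝔓 hn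

variable {M : Type u} [AddCommGroup M] [DistribMulAction (absoluteGaloisGroup K) M]
  [TopologicalSpace M] [DiscreteTopology M]

/-- **`Φ(a, b)` vanishes on inertia at the places `w ∤ P·a·b`** (Clark–Sharif §3.2/§3.6: the
classes `θ = Φ(π, π')`, `Φ(π, 1)` "trivialize over `K_w^{unr}`" at a good place `w ≠ v, v'`).
For `a, b ∈ kˣ` images of algebraic integers `x, y ∉ 𝔓` and `P ∉ 𝔓`, the cocycle
`Φ(a, b) : n ↦ ρ(f_a(n), f_b(n))` of `𝔤_k` is zero at every `n ∈ 𝔤_k ∩ I_𝔓`.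
[cite: ClarkSharif2010, §3.2 (proof of Thm. 1, last paragraph) and §3.6 (last paragraph)] -/
theorem kummerPhiCocycle_apply_eq_zero_of_mem_inertia (hζ : IsPrimitiveRoot ζ P) (hζk : ζ ∈ k)
    (htriv : ∀ (n : fixingGal k) (m : M), n • m = m) (ρ : ZMod P × ZMod P →+ M) (a b : (↥k)ˣ)
    {x y : absIntegers (𝓞 K) K} (hx : (x : AlgebraicClosure K) = ((a : k) : AlgebraicClosure K))
    (hy : (y : AlgebraicClosure K) = ((b : k) : AlgebraicClosure K))
    {𝔓 : Ideal (absIntegers (𝓞 K) K)} [𝔓.IsPrime] (hx𝔓 : x ∉ 𝔓) (hy𝔓 : y ∉ 𝔓)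
    (hP𝔓 : ((P : ℕ) : absIntegers (𝓞 K) K) ∉ 𝔓) {n : fixingGal k}
    (hn : (n : absoluteGaloisGroup K) ∈ 𝔓.inertia (absoluteGaloisGroup K)) :
    (kummerPhiCocycle hζ hζk htriv ρ a b).1 n = 0 := by
  rw [kummerPhiCocycle_apply, unitChar_eq_zero_of_mem_inertia hζ a hx hx𝔓 hP𝔓 hn,
    unitChar_eq_zero_of_mem_inertia hζ b hy hy𝔓 hP𝔓 hn, Prod.mk_zero_zero, map_zero]

end Literature.NumberTheory.EllipticCurves
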